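import Mathlib
import Summits.Ventures.LatticeQCDFlow.Scoring.LagProductCovariance
import Summits.Ventures.LatticeQCDFlow.Scoring.FejerPairSums
import Summits.Ventures.LatticeQCDFlow.Scoring.BartlettKernel
import HarnessLib

/-!
# The scorers' normalisation `Γ̂(t) = (1/(N−t)) Σ_{i<N−t} xᵢ x_{i+t}`: unbiased from `N` samples, and Bartlett's limit `N · cov → B(s,t)` is unchanged

HONEST FRAMING: exact (Metropolis-corrected) sampling algorithms for lattice gauge theory;
figures of merit are autocorrelation/cost numbers at stated couplings and volumes; no
continuum-physics claim.

Venture `LatticeQCDFlow` (cell pub-lqcd), sub-topic `Scoring`; FANOUT row 16 (`su2-base`), GEN-6.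
NEW WORK of the cell over this packet (`LagProductCovariance`: Wick families, `covariance_mul_mul`;
`FejerPairSums`: the square Fejér limit; `BartlettKernel`: `B(s,t)`).  Nothing is cited as a fact.
Printed counterparts, NAMED ONLY: Wolff 2004 eq. (31) (the Γ-method's `Γ̂(t)` with `1/(N−t)`);
Priestley 1981 §5.3.3 (the two normalisations `1/N` vs `1/(N−t)` have the same asymptotic
covariances).

Eleventh file of the ERROR-OF-THE-ERROR packet — it removes the '`1/(N−t)` convention NOT modelled'
clause of `LagProductCovariance`: the packet's `acovHat X N t = (1/N) Σ_{i<N} XᵢX_{i+t}` reads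
`N + t` samples; the frozen scorers (A `gamma.py`, B `scorer_b.py`) use, from `N` samples,
`Γ̂(t) = (1/(N−t)) Σ_{i<N−t} xᵢ x_{i+t}` (mean subtraction aside).

* `acovHatN X N t = (Σ_{i<N−t} XᵢX_{i+t})/(N − t)` (`= 0` for `t ≥ N`); `integral_acovHatN` —
  UNBIASED: `E[Γ̂(t)] = c(t)` for `t < N` under stationarity;
* **`IsWickFamily.covariance_acovHatN_of_stationary`** — EXACT:
  `cov[Γ̂(s), Γ̂(t)] = Σ_{i<N−s} Σ_{j<N−t} g_{s,t}(j−i) / ((N−s)(N−t))` (a RECTANGULAR pair sum);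
* `abs_sum_sum_sub_rect_le` — square minus rectangle: for summable `g`,
  `|Σ_{i<N}Σ_{j<N} g(j−i) − Σ_{i<N−s}Σ_{j<N−t} g(j−i)| ≤ (s + t)·Σ_ℤ|g|` (`s, t ≤ N`) — the dropped
  rows and columns each carry at most one full mass of `|g|`;
  `tendsto_sum_sum_rect_div` — hence `(1/N) Σ_{i<N−s}Σ_{j<N−t} g(j−i) → Σ_ℤ g` too;
* **`IsWickFamily.tendsto_covariance_acovHatN`** — BARTLETT'S FORMULA for the scorers'
  normalisation: `N · cov[Γ̂(s), Γ̂(t)] → B(s,t)` (`N²/((N−s)(N−t)) → 1`), so every `N → ∞`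
  statement of the packet (`V(W)`, `R(W)`, the Madras–Sokal asymptote and its constants) applies
  verbatim to the scorers' `Γ̂`.

NOT CLAIMED: mean subtraction (`xᵢ − x̄`: an `O(1/N)` shift of each `Γ̂(t)`, same limits — not
typed); finite-`N` comparisons between the two normalisations beyond the stated bound.
-/

noncomputable section

open MeasureTheory ProbabilityTheory Finset Filter Topology

namespace Summit.Ventures.LatticeQCDFlow.Scoring

variable {Ω : Type*} {mΩ : MeasurableSpace Ω} {μ : Measure Ω}

/-- The scorers' empirical autocovariance from `N` samples (known mean):
`Γ̂(t) = (1/(N−t)) Σ_{i<N−t} Xᵢ X_{i+t}` (natural-number subtraction: `0` for `t ≥ N`). [ours] -/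
def acovHatN (X : ℕ → Ω → ℝ) (N t : ℕ) : Ω → ℝ :=
  fun ω => (∑ i ∈ range (N - t), X i ω * X (i + t) ω) / ((N - t : ℕ) : ℝ)

/-- `Γ̂(t)` IS the packet's `acovHat` run on `N − t` lag products: `acovHatN X N t = acovHat X (N−t) t`. -/
theorem acovHatN_eq_acovHat (X : ℕ → Ω → ℝ) (N t : ℕ) : acovHatN X N t = acovHat X (N - t) t := by
  funext ω
  rw [acovHatN, acovHat_apply]

namespace IsWickFamily

variable {X : ℕ → Ω → ℝ} {C : ℕ → ℕ → ℝ} {c : ℤ → ℝ}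

/-- `Γ̂(t)` is square integrable. -/
theorem memLp_acovHatN (h : IsWickFamily X C μ) (N t : ℕ) : MemLp (acovHatN X N t) 2 μ := by
  rw [acovHatN_eq_acovHat]
  exact h.memLp_acovHat _ _

/-- **Unbiasedness from `N` samples**: `E[Γ̂(t)] = c(t)` for `t < N` under stationarity. -/
theorem integral_acovHatN [IsFiniteMeasure μ] (h : IsWickFamily X C μ)
    (hC : ∀ i j, C i j = c ((j : ℤ) - i)) {N t : ℕ} (ht : t < N) :
    ∫ ω, acovHatN X N t ω ∂μ = c t := by
  rw [acovHatN_eq_acovHat]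
  exact h.integral_acovHat_of_stationary hC (by omega) t

/-- **Exact covariance, scorers' normalisation**: a rectangular Bartlett pair sum,
`cov[Γ̂(s), Γ̂(t)] = Σ_{i<N−s} Σ_{j<N−t} g_{s,t}(j−i) / ((N−s)(N−t))`. -/
theorem covariance_acovHatN_of_stationary [IsProbabilityMeasure μ] (h : IsWickFamily X C μ)
    (hC : ∀ i j, C i j = c ((j : ℤ) - i)) (N s t : ℕ) :
    cov[acovHatN X N s, acovHatN X N t; μ]
      = (∑ i ∈ range (N - s), ∑ j ∈ range (N - t), bartlettSummand c s t ((j : ℤ) - i))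
        / (((N - s : ℕ) : ℝ) * ((N - t : ℕ) : ℝ)) := by
  unfold acovHatN
  rw [covariance_fun_div_left, covariance_fun_div_right,
    covariance_fun_sum_fun_sum' (fun i _ => h.memLp i (i + s)) (fun j _ => h.memLp j (j + t))]
  simp_rw [h.covariance_mul_mul]
  rw [div_div]
  congr 1
  · refine sum_congr rfl fun i _ => sum_congr rfl fun j _ => ?_
    simp only [bartlettSummand, hC]
    have e1 : (((j + t : ℕ) : ℤ) - ((i + s : ℕ) : ℤ)) = (j : ℤ) - i + t - s := by push_cast; ring
    have e2 : (((j + t : ℕ) : ℤ) - (i : ℤ)) = (j : ℤ) - i + t := by push_cast; ring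
    have e3 : ((j : ℤ) - ((i + s : ℕ) : ℤ)) = (j : ℤ) - i - s := by push_cast; ring
    rw [e1, e2, e3]
  · exact mul_comm _ _

end IsWickFamily

/-! ## Square versus rectangle -/

/-- A finite window of a summable `g` along any row has mass at most `Σ_ℤ |g|`:
`Σ_{j<M} |g(j − i)| ≤ Σ_{u∈ℤ} |g(u)|`. -/
theorem sum_range_abs_int_sub_le {g : ℤ → ℝ} (hg : Summable g) (i : ℤ) (M : ℕ) :
    ∑ j ∈ range M, |g ((j : ℤ) - i)| ≤ ∑' u, |g u| := by
  set f : ℕ → ℤ := fun j => (j : ℤ) - i with hf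
  have hinj : Set.InjOn f (range M : Finset ℕ) := fun a _ b _ hab => by
    simp only [hf] at hab
    omega
  calc ∑ j ∈ range M, |g ((j : ℤ) - i)| = ∑ u ∈ (range M).image f, |g u| := by
        rw [sum_image hinj]
    _ ≤ ∑' u, |g u| := hg.abs.sum_le_tsum _ fun u _ => abs_nonneg _

/-- The same along a column: `Σ_{i<M} |g(j − i)| ≤ Σ_{u∈ℤ} |g(u)|`. -/
theorem sum_range_abs_int_sub_le' {g : ℤ → ℝ} (hg : Summable g) (j : ℤ) (M : ℕ) :
    ∑ i ∈ range M, |g (j - (i : ℤ))| ≤ ∑' u, |g u| := by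
  set f : ℕ → ℤ := fun i => j - (i : ℤ) with hf
  have hinj : Set.InjOn f (range M : Finset ℕ) := fun a _ b _ hab => by
    simp only [hf] at hab
    omega
  calc ∑ i ∈ range M, |g (j - (i : ℤ))| = ∑ u ∈ (range M).image f, |g u| := by
        rw [sum_image hinj]
    _ ≤ ∑' u, |g u| := hg.abs.sum_le_tsum _ fun u _ => abs_nonneg _

/-- **Square minus rectangle.**  For summable `g` and `s, t ≤ N`:
`|Σ_{i<N}Σ_{j<N} g(j−i) − Σ_{i<N−s}Σ_{j<N−t} g(j−i)| ≤ (s + t) · Σ_ℤ |g|`. -/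
theorem abs_sum_sum_sub_rect_le {g : ℤ → ℝ} (hg : Summable g) {N s t : ℕ} (hs : s ≤ N) (ht : t ≤ N) :
    |(∑ i ∈ range N, ∑ j ∈ range N, g ((j : ℤ) - i))
        - ∑ i ∈ range (N - s), ∑ j ∈ range (N - t), g ((j : ℤ) - i)|
      ≤ ((s : ℝ) + t) * ∑' u, |g u| := by
  set G : ℝ := ∑' u, |g u| with hG
  have hG0 : 0 ≤ G := tsum_nonneg fun u => abs_nonneg _
  -- split the rows: `range N = range (N−s) ∪ Ico (N−s) N`
  have hrow : ∑ i ∈ range N, ∑ j ∈ range N, g ((j : ℤ) - i)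
      = ∑ i ∈ range (N - s), ∑ j ∈ range N, g ((j : ℤ) - i)
        + ∑ i ∈ Ico (N - s) N, ∑ j ∈ range N, g ((j : ℤ) - i) :=
    (sum_range_add_sum_Ico _ (Nat.sub_le N s)).symm
  -- split the columns inside the kept rows
  have hcol : ∑ i ∈ range (N - s), ∑ j ∈ range N, g ((j : ℤ) - i)
      = ∑ i ∈ range (N - s), ∑ j ∈ range (N - t), g ((j : ℤ) - i)
        + ∑ i ∈ range (N - s), ∑ j ∈ Ico (N - t) N, g ((j : ℤ) - i) := by
    rw [← sum_add_distrib]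
    exact sum_congr rfl fun i _ => (sum_range_add_sum_Ico _ (Nat.sub_le N t)).symm
  rw [hrow, hcol]
  have e : ∀ a b c : ℝ, a + b + c - a = b + c := fun a b c => by ring
  rw [e]
  -- the dropped columns: `(N − s) · ?` no — bound each kept ROW's dropped part by the column count
  have hB1 : |∑ i ∈ range (N - s), ∑ j ∈ Ico (N - t) N, g ((j : ℤ) - i)| ≤ (t : ℝ) * G := by
    rw [sum_comm]
    refine (abs_sum_le_sum_abs _ _).trans ?_
    have : ∀ j ∈ Ico (N - t) N, |∑ i ∈ range (N - s), g ((j : ℤ) - i)| ≤ G := fun j _ =>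
      (abs_sum_le_sum_abs _ _).trans (sum_range_abs_int_sub_le' hg _ _)
    refine (sum_le_sum this).trans ?_
    rw [sum_const, Nat.card_Ico, nsmul_eq_mul]
    gcongr
    exact_mod_cast (by omega : N - (N - t) ≤ t)
  have hB2 : |∑ i ∈ Ico (N - s) N, ∑ j ∈ range N, g ((j : ℤ) - i)| ≤ (s : ℝ) * G := by
    refine (abs_sum_le_sum_abs _ _).trans ?_
    have : ∀ i ∈ Ico (N - s) N, |∑ j ∈ range N, g ((j : ℤ) - i)| ≤ G := fun i _ =>
      (abs_sum_le_sum_abs _ _).trans (sum_range_abs_int_sub_le hg _ _)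
    refine (sum_le_sum this).trans ?_
    rw [sum_const, Nat.card_Ico, nsmul_eq_mul]
    gcongr
    exact_mod_cast (by omega : N - (N - s) ≤ s)
  calc |∑ i ∈ range (N - s), ∑ j ∈ Ico (N - t) N, g ((j : ℤ) - i)
        + ∑ i ∈ Ico (N - s) N, ∑ j ∈ range N, g ((j : ℤ) - i)|
      ≤ (t : ℝ) * G + (s : ℝ) * G := (abs_add_le _ _).trans (add_le_add hB1 hB2)
    _ = ((s : ℝ) + t) * G := by ring

/-- **The rectangular Fejér limit**: `(1/N) Σ_{i<N−s}Σ_{j<N−t} g(j−i) → Σ_ℤ g`. -/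
theorem tendsto_sum_sum_rect_div {g : ℤ → ℝ} (hg : Summable g) (s t : ℕ) :
    Tendsto (fun N : ℕ => (∑ i ∈ range (N - s), ∑ j ∈ range (N - t), g ((j : ℤ) - i)) / N)
      atTop (𝓝 (∑' m, g m)) := by
  have hsq := tendsto_sum_sum_int_sub_div hg
  -- the difference is `O(1)/N`
  have hdiff : Tendsto (fun N : ℕ => ((∑ i ∈ range N, ∑ j ∈ range N, g ((j : ℤ) - i))
      - ∑ i ∈ range (N - s), ∑ j ∈ range (N - t), g ((j : ℤ) - i)) / N) atTop (𝓝 0) := by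
    have hb : Tendsto (fun N : ℕ => (((s : ℝ) + t) * ∑' u, |g u|) / N) atTop (𝓝 0) :=
      tendsto_const_div_atTop_nhds_zero_nat _
    refine squeeze_zero_norm' ?_ hb
    filter_upwards [eventually_ge_atTop (max s t)] with N hN
    rw [Real.norm_eq_abs, abs_div, Nat.abs_cast]
    gcongr
    exact abs_sum_sum_sub_rect_le hg (le_of_max_le_left hN) (le_of_max_le_right hN)
  have := hsq.sub hdiff
  rw [sub_zero] at this
  refine this.congr fun N => ?_
  ring

namespace IsWickFamily

variable [IsProbabilityMeasure μ] {X : ℕ → Ω → ℝ} {C : ℕ → ℕ → ℝ} {c : ℤ → ℝ}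

/-- `N² / ((N−s)(N−t)) → 1`. -/
theorem tendsto_sq_div_sub_mul_sub (s t : ℕ) :
    Tendsto (fun N : ℕ => (N : ℝ) * N / (((N - s : ℕ) : ℝ) * ((N - t : ℕ) : ℝ))) atTop (𝓝 1) := by
  have h1 : Tendsto (fun N : ℕ => ((N - s : ℕ) : ℝ) / N) atTop (𝓝 1) := by
    have : Tendsto (fun N : ℕ => 1 - (s : ℝ) / N) atTop (𝓝 (1 - 0)) :=
      tendsto_const_nhds.sub (tendsto_const_div_atTop_nhds_zero_nat _)
    rw [sub_zero] at this
    refine this.congr' ?_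
    filter_upwards [eventually_ge_atTop (max s 1)] with N hN
    have hN0 : (N : ℝ) ≠ 0 := by
      have : 1 ≤ N := le_of_max_le_right hN
      positivity
    rw [Nat.cast_sub (le_of_max_le_left hN)]
    field_simp
  have h2 : Tendsto (fun N : ℕ => ((N - t : ℕ) : ℝ) / N) atTop (𝓝 1) := by
    have : Tendsto (fun N : ℕ => 1 - (t : ℝ) / N) atTop (𝓝 (1 - 0)) :=
      tendsto_const_nhds.sub (tendsto_const_div_atTop_nhds_zero_nat _)
    rw [sub_zero] at this
    refine this.congr' ?_
    filter_upwards [eventually_ge_atTop (max t 1)] with N hN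
    have hN0 : (N : ℝ) ≠ 0 := by
      have : 1 ≤ N := le_of_max_le_right hN
      positivity
    rw [Nat.cast_sub (le_of_max_le_left hN)]
    field_simp
  have h12 := (h1.mul h2).inv₀ (by norm_num)
  rw [mul_one, inv_one] at h12
  refine h12.congr' ?_
  filter_upwards [eventually_gt_atTop (max s t)] with N hN
  have hN0 : (N : ℝ) ≠ 0 := by
    have : 0 < N := lt_of_le_of_lt (Nat.zero_le _) hN
    positivity
  have hs' : ((N - s : ℕ) : ℝ) ≠ 0 := by
    have : 0 < N - s := Nat.sub_pos_of_lt (lt_of_le_of_lt (le_max_left _ _) hN)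
    positivity
  have ht' : ((N - t : ℕ) : ℝ) ≠ 0 := by
    have : 0 < N - t := Nat.sub_pos_of_lt (lt_of_le_of_lt (le_max_right _ _) hN)
    positivity
  field_simp

/-- **Bartlett's formula for the scorers' normalisation**: for a stationary Wick family with
summable covariance, `N · cov[Γ̂(s), Γ̂(t)] → B(s,t)`, exactly as for `acovHat`. -/
theorem tendsto_covariance_acovHatN (h : IsWickFamily X C μ) (hC : ∀ i j, C i j = c ((j : ℤ) - i))
    (hc : Summable c) (s t : ℕ) :
    Tendsto (fun N : ℕ => (N : ℝ) * cov[acovHatN X N s, acovHatN X N t; μ]) atTop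
      (𝓝 (bartlettKernel c s t)) := by
  have hrect := tendsto_sum_sum_rect_div (summable_bartlettSummand hc s t) s t
  rw [tsum_bartlettSummand hc s t] at hrect
  have := (tendsto_sq_div_sub_mul_sub s t).mul hrect
  rw [one_mul] at this
  refine this.congr' ?_
  filter_upwards [eventually_gt_atTop (max s t)] with N hN
  have hN0 : (N : ℝ) ≠ 0 := by
    have : 0 < N := lt_of_le_of_lt (Nat.zero_le _) hN
    positivity
  rw [h.covariance_acovHatN_of_stationary hC]
  field_simp

end IsWickFamily

end Summit.Ventures.LatticeQCDFlow.Scoring
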